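import Literature.Probability.LatticeModels.PlaneRotatorStiffnessTwoPointBound
import Literature.Probability.LatticeModels.PlaneRotatorTorusBoxCriterion
import Literature.Probability.LatticeModels.PlaneRotatorStiffnessHighTemperatureLieb
import HarnessLib

/-!
# The torus helicity modulus vanishes under Lieb's box criterion of ANY radius:
# `S_R(K) < 1` for one `R ≥ 1` ⟹ `βΥ_L(K) → 0` (the Lieb–Simon finite algorithm for the stiffness)

Topic `Literature/Probability/LatticeModels`. Assembly of

* `abs_torusXYStiffness_le_of_twoPoint_bound_torusDist` (`PlaneRotatorStiffnessTwoPointBound.lean`, p552758):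
  `|βΥ_L(K)| ≤ 4K²L²·B²` from a bound `B` on the torus two-point function at distance `≥ ⌊L/2⌋ − 1`
  (cut–cut covariance identity × Bricmont–Fontaine–Landau Thm A2 decoupling);
* `torusXY_expectJ_cosDiff_le_pow_nnBoxShellSum` (`PlaneRotatorTorusBoxCriterion.lean`, p552872): Lieb's box
  criterion on `(ℤ/Lℤ)²`, `⟨cos(θ_a − θ_c)⟩_{K,L} ≤ S_R(K)^{⌊dist_∞(a,c)/R⌋}` for `L ≥ 2R + 2`, `S_R(K) = nnBoxShellSum K 2 R`
  (Lieb 1980 Thm 4 / p. 128 with Simon 1980 Thm 1.3);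
* the finite-volume positivity `βΥ_L(K) > 0` and the typing rule (`torusXYStiffness_pos`,
  `torusXY_not_uniform_decay_of_tendsto`; `PlaneRotatorStiffnessHighTemperatureLieb.lean`, `PlaneRotatorPathFloor.lean`).

## Contents (everything PROVED; no definition, no named fact)

* §1 `nnBoxShellSum_mono` (`S_R(K)` non-decreasing in `K`); `abs_torusXYStiffness_le_nnBoxShellSum`: for `R ≥ 1`,
  `L ≥ max(4, 2R+2)`, `K ≥ 0`, `S_R(K) ≤ 1`: `|βΥ_L(K)| ≤ 4K²L²·S_R(K)^{2⌊(⌊L/2⌋−1)/R⌋}` (+ `Icc` form).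
* §2 **`tendsto_torusXYStiffness_of_nnBoxShellSum_lt_one`**: `R ≥ 1`, `K ≥ 0`, `S_R(K) < 1` ⟹ `βΥ_{L}(K) → 0` as
  `L → ∞` (polynomial × geometric majorant); `eventually_torusXYStiffness_lt_of_nnBoxShellSum_lt_one`; the criterion
  certifies the whole interval `0 ≤ K ≤ K₀` (`…_of_le`).
* §3 **Crux typing corollary** `torusXY_not_uniform_decay_stiffnessExponent_of_nnBoxShellSum_lt_one`: for `K > 0`
  with `S_R(K) < 1` for some `R ≥ 1`, no volume-uniform decay bound `A·B^{η_L}(dist+1)^{−η_L}` with the stiffness-class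
  exponent `η_L = 1/(2πβΥ_L(K))` holds for all `L ≥ 3`.
* §4 **Simon's form** (`nnBoxShellSum_le_sum_shell_twoPoint`): `S_R(K) ≤ ∑_{b ∈ Λ, ‖b‖_∞ = R} ⟨cos(θ_0 − θ_b)⟩_{Λ,K}`
  for every finite free box `Λ ⊇ [−R,R]^ν` (Griffiths–Ginibre); hence a shell sum `< 1` of the two-point function in
  some finite volume already gives `βΥ_L(K) → 0` (`tendsto_torusXYStiffness_of_shell_sum_lt_one`) — and, by Griffiths'
  second inequality towards the infinite volume, `S_R(K) < 1` for some `R` wherever the infinite-volume two-point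
  function is `o(1/‖x‖)` on shells (the massive phase; not formalised here). Read backwards
  (`one_le_sum_shell_twoPoint_of_not_tendsto_torusXYStiffness`, `one_le_nnBoxShellSum_of_not_tendsto_…`): a phase with
  `Υ_L ↛ 0` has every shell sum `≥ 1`, i.e. two-point functions no faster than `1/(8‖x‖_∞)` along shells.

Reading (cell `pub/hubbard-tc`, MO-S3, crux №2 classical side; number-neutral, classical comparison model, K2
untouched): engine 2 of the high-temperature vanishing of `Υ_L` extends from Lieb's star (`R = 1`:
`S_1 = 4u(K) < 1 ⇔ K < u⁻¹(¼) ≈ 0.516`, `tendsto_torusXYStiffness_lieb`) to the **Lieb–Simon FINITE ALGORITHM**: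
`βΥ_L(K) → 0` at every `K` where ONE box number `S_R(K) < 1`. No value of `S_R(K)` for `R ≥ 2` is asserted in the
kernel (the cell's certified enclosure `S_2(0.663) < 1 < S_2(0.664)` is a producer certificate, K5-LIEB-BOX-R2, not a
tree declaration); by Simon–Lieb, `S_R(K) < 1` for some `R` wherever the infinite-volume two-point function is summably
small on large shells, i.e. throughout the massive phase.

## What this is not

A classical comparison-model statement; nothing electronic; no number of the cell's tables moves; not `Υ_∞ > 0` at
low temperature (Fröhlich–Spencer) nor the jump.

## References

* E. H. Lieb, Comm. Math. Phys. 77 (1980) 127, Theorem 4 and p. 128 (boxes; finite algorithm). [Lieb1980]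
* B. Simon, Comm. Math. Phys. 77 (1980) 111, Thm 1.3. [Simon1980CMP]
* J. Bricmont, J.-R. Fontaine, L. J. Landau, Comm. Math. Phys. 56 (1977) 281, Appendix Thm A2.
  [BricmontFontaineLandau1977]
* M. E. Fisher, M. N. Barber, D. Jasnow, Phys. Rev. A 8 (1973) 1111, §II. [FisherBarberJasnow1973]
-/

noncomputable section

open MeasureTheory Finset Filter
open scoped BigOperators Topology

namespace Literature.Probability.LatticeModels

open PlaneRotator Literature.Barriers.CriticalPhenomena Literature.Barriers.CriticalPhenomena.LongRangeIsing
open Literature.MathematicalPhysics.QuantumLattice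

variable {L : ℕ} [NeZero L] [MeasurableSpace Circle] [BorelSpace Circle]

/-! ## §1 The helicity modulus under the box criterion -/

section Bound

/-- `S_R(K) ≥ 0`. [cite: Lieb1980, p. 128 (φ(β) for a box) — plumbing] -/
theorem nnBoxShellSum_nonneg {K : ℝ} (hK : 0 ≤ K) (ν R : ℕ) : 0 ≤ nnBoxShellSum K ν R :=
  boxShellSum_nonneg (fun _ _ => mul_nonneg (div_nonneg hK zero_le_two) (nnCoupling_nonneg _ _)) R

/-- **`S_R(K)` is non-decreasing in `K ≥ 0`** (Griffiths–Ginibre: the reference couplings `K/2·ν` increase with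
`K`), so a box criterion `S_R(K₀) < 1` certifies the whole interval `0 ≤ K ≤ K₀`. [cite: Lieb1980, p. 128 (β < β_c from φ(β) < 1); Ginibre1970, Prop. 3 with Example 4 (monotonicity in the couplings)] -/
theorem nnBoxShellSum_mono {K K' : ℝ} (hK : 0 ≤ K) (hKK' : K ≤ K') (ν R : ℕ) :
    nnBoxShellSum K ν R ≤ nnBoxShellSum K' ν R := by
  unfold nnBoxShellSum boxShellSum
  refine Finset.sum_le_sum fun b _ => twoPoint_mono (refCoupling_nonneg
    (fun _ _ => mul_nonneg (div_nonneg hK zero_le_two) (nnCoupling_nonneg _ _)) R) (fun p => ?_) _ _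
  unfold refCoupling
  split_ifs
  · exact le_rfl
  · exact mul_le_mul_of_nonneg_right (by linarith) (nnCoupling_nonneg _ _)

/-- **The helicity modulus under Lieb's box criterion.** For `R ≥ 1`, `L ≥ 4`, `L ≥ 2R + 2`, `K ≥ 0` and
`S_R(K) ≤ 1` (`S_R(K) = nnBoxShellSum K 2 R`):
`|βΥ_L(K)| ≤ 4K²L²·S_R(K)^{2⌊(⌊L/2⌋ − 1)/R⌋}` — every pair of sites at torus distance `≥ ⌊L/2⌋ − 1` has two-point
function `≤ S_R^{⌊(⌊L/2⌋−1)/R⌋}` by the torus box criterion, and the generic cut–cut bound squares it.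
[cite: Lieb1980, Theorem 4 and p. 128 (decay input); BricmontFontaineLandau1977 Appendix Thm A2 (decoupling); FisherBarberJasnow1973 §II (Υ)] -/
theorem abs_torusXYStiffness_le_nnBoxShellSum {R : ℕ} (hR : 1 ≤ R) (hL : 4 ≤ L) (hLR : 2 * R + 2 ≤ L) {K : ℝ}
    (hK : 0 ≤ K) (hS1 : nnBoxShellSum K 2 R ≤ 1) :
    |torusXYStiffness L K| ≤
      4 * K ^ 2 * (L : ℝ) ^ 2 * (nnBoxShellSum K 2 R ^ ((L / 2 - 1) / R)) ^ 2 := by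
  have hS0 := nnBoxShellSum_nonneg hK 2 R
  refine abs_torusXYStiffness_le_of_twoPoint_bound_torusDist hL hK (pow_nonneg hS0 _) fun a c hac => ?_
  exact torusXY_expectJ_cosDiff_le_pow_of_le_torusDist hR hLR hK hS1
    ((Nat.div_mul_le_self (L / 2 - 1) R).trans hac)

/-- The same with the tree's floor: `0 ≤ βΥ_L(K) ≤ 4K²L²·S_R(K)^{2⌊(⌊L/2⌋−1)/R⌋}`. [cite: Lieb1980, Theorem 4 and p. 128; BricmontFontaineLandau1977 Appendix Thm A2] -/
theorem torusXYStiffness_mem_Icc_nnBoxShellSum {R : ℕ} (hR : 1 ≤ R) (hL : 4 ≤ L) (hLR : 2 * R + 2 ≤ L) {K : ℝ}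
    (hK : 0 ≤ K) (hS1 : nnBoxShellSum K 2 R ≤ 1) :
    torusXYStiffness L K ∈
      Set.Icc 0 (4 * K ^ 2 * (L : ℝ) ^ 2 * (nnBoxShellSum K 2 R ^ ((L / 2 - 1) / R)) ^ 2) :=
  ⟨torusXYStiffness_nonneg hK, (le_abs_self _).trans (abs_torusXYStiffness_le_nnBoxShellSum hR hL hLR hK hS1)⟩

end Bound

/-! ## §2 `βΥ_L(K) → 0` whenever one box number is `< 1` -/

section Limit

omit [NeZero L] in
/-- **The Lieb–Simon finite algorithm for the stiffness**: if `S_R(K) < 1` for ONE radius `R ≥ 1` (`K ≥ 0`), then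
`βΥ_L(K) → 0` as `L → ∞` — the majorant `4K²L²·S_R^{2⌊(⌊L/2⌋−1)/R⌋}` is a polynomial times a geometric sequence in
`n = ⌊(⌊L/2⌋−1)/R⌋` (`L ≤ 2R(n+1) + 2`). `R = 1` is Lieb's star (`tendsto_torusXYStiffness_lieb`, `S_1 = 4u(K)`).
[cite: Lieb1980, Theorem 4 and p. 128 (φ(β) < 1 for some box ⇒ exponential decay: a finite algorithm); Simon1980CMP Thm 1.3] -/
theorem tendsto_torusXYStiffness_of_nnBoxShellSum_lt_one {R : ℕ} (hR : 1 ≤ R) {K : ℝ} (hK : 0 ≤ K)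
    (hS : nnBoxShellSum K 2 R < 1) :
    Tendsto (fun L : ℕ => torusXYStiffness (L + 1) K) atTop (𝓝 0) := by
  set S : ℝ := nnBoxShellSum K 2 R with hSdef
  have hS0 : 0 ≤ S := nnBoxShellSum_nonneg hK 2 R
  set r : ℝ := S ^ 2 with hr
  have hr0 : 0 ≤ r := by positivity
  have hr1 : |r| < 1 := by
    rw [abs_of_nonneg hr0, hr]
    nlinarith
  have hR0 : (0 : ℝ) < R := by exact_mod_cast hR
  -- the majorant along `n ↦ 4K²(2Rn + 2R + 2)² r^n`
  have hg : Tendsto (fun n : ℕ => 4 * K ^ 2 * ((2 * R * (n : ℝ) + (2 * R + 2)) ^ 2 * r ^ n)) atTop (𝓝 0) := by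
    have h2 := tendsto_pow_const_mul_const_pow_of_abs_lt_one 2 hr1
    have h1' := tendsto_pow_const_mul_const_pow_of_abs_lt_one 1 hr1
    have h0 := tendsto_pow_const_mul_const_pow_of_abs_lt_one 0 hr1
    have hsum : Tendsto (fun n : ℕ => (2 * (R : ℝ)) ^ 2 * ((n : ℝ) ^ 2 * r ^ n) +
        2 * (2 * R) * (2 * R + 2) * ((n : ℝ) ^ 1 * r ^ n) + (2 * (R : ℝ) + 2) ^ 2 * ((n : ℝ) ^ 0 * r ^ n))
        atTop (𝓝 0) := by
      have := ((h2.const_mul ((2 * (R : ℝ)) ^ 2)).add (h1'.const_mul (2 * (2 * (R : ℝ)) * (2 * R + 2)))).add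
        (h0.const_mul ((2 * (R : ℝ) + 2) ^ 2))
      simpa using this
    have := hsum.const_mul (4 * K ^ 2)
    rw [mul_zero] at this
    refine this.congr fun n => ?_
    ring
  -- compose with `L ↦ ⌊((L+1)/2 − 1)/R⌋ → ∞`
  have hidx : Tendsto (fun L : ℕ => ((L + 1) / 2 - 1) / R) atTop atTop := by
    refine tendsto_atTop_atTop.2 fun b => ⟨2 * (b * R) + 2, fun L hL => ?_⟩
    refine (Nat.le_div_iff_mul_le hR).2 ?_
    omega
  refine tendsto_torusXYStiffness_of_abs_le hK (hg.comp hidx) ?_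
  filter_upwards [eventually_ge_atTop (2 * R + 2)] with L hL
  have hb := abs_torusXYStiffness_le_nnBoxShellSum (L := L + 1) hR (by omega) (by omega) hK hS.le
  refine hb.trans ?_
  simp only [Function.comp]
  set n : ℕ := ((L + 1) / 2 - 1) / R with hn
  -- `L + 1 ≤ 2R(n + 1) + 2`
  have hLn : ((L + 1 : ℕ) : ℝ) ≤ 2 * R * (n : ℝ) + (2 * R + 2) := by
    have h1 : (L + 1) / 2 - 1 < R * (n + 1) := by
      rw [hn]; exact Nat.lt_mul_div_succ _ hR
    have h2 : (L + 1 : ℕ) ≤ 2 * (R * n) + (2 * R + 2) := by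
      have : (L + 1) / 2 ≤ R * n + R := by
        have := h1; rw [Nat.mul_succ] at this; omega
      omega
    have h3 : ((L + 1 : ℕ) : ℝ) ≤ ((2 * (R * n) + (2 * R + 2) : ℕ) : ℝ) := by exact_mod_cast h2
    push_cast at h3 ⊢
    linarith
  have hpow : (S ^ n) ^ 2 = r ^ n := by rw [hr, ← pow_mul, ← pow_mul, mul_comm]
  rw [hpow]
  have hL0 : (0 : ℝ) ≤ ((L + 1 : ℕ) : ℝ) := Nat.cast_nonneg _
  have hrn : 0 ≤ r ^ n := pow_nonneg hr0 _
  have hsq : ((L + 1 : ℕ) : ℝ) ^ 2 ≤ (2 * R * (n : ℝ) + (2 * R + 2)) ^ 2 := pow_le_pow_left₀ hL0 hLn 2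
  push_cast at hsq ⊢
  nlinarith [sq_nonneg K, mul_nonneg (mul_nonneg (sq_nonneg K) hrn) (sub_nonneg.2 hsq)]

omit [NeZero L] in
/-- For every `ε > 0`, eventually in `L`: `0 ≤ βΥ_L(K) < ε` under the box criterion `S_R(K) < 1`. [cite: Lieb1980, Theorem 4 and p. 128 (boxes)] -/
theorem eventually_torusXYStiffness_lt_of_nnBoxShellSum_lt_one {R : ℕ} (hR : 1 ≤ R) {K : ℝ} (hK : 0 ≤ K)
    (hS : nnBoxShellSum K 2 R < 1) {ε : ℝ} (hε : 0 < ε) :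
    ∀ᶠ L : ℕ in atTop, 0 ≤ torusXYStiffness (L + 1) K ∧ torusXYStiffness (L + 1) K < ε := by
  filter_upwards [(tendsto_order.1 (tendsto_torusXYStiffness_of_nnBoxShellSum_lt_one hR hK hS)).2 ε hε]
    with L hL
  exact ⟨torusXYStiffness_nonneg hK, hL⟩

omit [NeZero L] in
/-- **The criterion certifies an interval**: `S_R(K₀) < 1` for one `R ≥ 1` gives `βΥ_L(K) → 0` for EVERY
`0 ≤ K ≤ K₀` (monotonicity of `S_R`). [cite: Lieb1980, Theorem 4 and p. 128 (β < β_c)] -/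
theorem tendsto_torusXYStiffness_of_nnBoxShellSum_lt_one_of_le {R : ℕ} (hR : 1 ≤ R) {K K₀ : ℝ} (hK : 0 ≤ K)
    (hKK₀ : K ≤ K₀) (hS : nnBoxShellSum K₀ 2 R < 1) :
    Tendsto (fun L : ℕ => torusXYStiffness (L + 1) K) atTop (𝓝 0) :=
  tendsto_torusXYStiffness_of_nnBoxShellSum_lt_one hR hK ((nnBoxShellSum_mono hK hKK₀ 2 R).trans_lt hS)

end Limit

/-! ## §3 The crux corollary under the box criterion -/

section Crux

omit [NeZero L] in
/-- **No stiffness-class decay bound wherever a box criterion holds.** Let `K > 0` with `S_R(K) < 1` for some `R ≥ 1`,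
`A` real, `B > 0`. It is FALSE that for every `L ≥ 3` and all sites `x, y` of `(ℤ/Lℤ)²`
`|⟨cos(θ_x − θ_y)⟩_{K,L}| ≤ A·B^{η_L}·(dist(x,y) + 1)^{−η_L}` with `η_L = 1/(2π·βΥ_L(K))`: `βΥ_L(K) > 0`
(`torusXYStiffness_pos`) and `βΥ_L(K) → 0` (§2) make `η_L → +∞`, which the Ginibre path floor forbids
(`torusXY_not_uniform_decay_of_tendsto`). Reading (crux №2 statement design): a finite-volume `Υ_L`-in-the-exponent
statement with constants uniform in `L` is refuted wherever ONE box number is `< 1`; it must carry a low-temperature /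
stiffness-window hypothesis or the `L → ∞` stiffness. [cite: Lieb1980, Theorem 4 and p. 128 (high-temperature input); McBryanSpencer1977 main theorem (form of the bound)] -/
theorem torusXY_not_uniform_decay_stiffnessExponent_of_nnBoxShellSum_lt_one {R : ℕ} (hR : 1 ≤ R) {K : ℝ}
    (hK : 0 < K) (hS : nnBoxShellSum K 2 R < 1) (A : ℝ) {B : ℝ} (hB : 0 < B) :
    ¬ ∀ (L : ℕ) [NeZero L], 3 ≤ L → ∀ x y : TorusSite 2 L,
        |(torusXY 2 L).expect K 1 (cosDiff x y)| ≤
          A * (B ^ (1 / (2 * Real.pi * torusXYStiffness L K)) *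
            ((torusDist x y : ℝ) + 1) ^ (-(1 / (2 * Real.pi * torusXYStiffness L K)))) := by
  classical
  -- the exponent as a total function of `L`
  set f : ℕ → ℝ := fun L => if h : L = 0 then 0 else
    1 / (2 * Real.pi * @torusXYStiffness _ _ L ⟨h⟩ K) with hf
  have hfL : ∀ (L : ℕ) [NeZero L], f L = 1 / (2 * Real.pi * torusXYStiffness L K) := by
    intro L _
    rw [hf]
    simp only [dif_neg (NeZero.ne L)]
  have hlim : Tendsto f atTop atTop := by
    rw [← tendsto_add_atTop_iff_nat 1]
    have hs : Tendsto (fun L : ℕ => torusXYStiffness (L + 1) K) atTop (𝓝[>] 0) :=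
      tendsto_nhdsWithin_iff.2 ⟨tendsto_torusXYStiffness_of_nnBoxShellSum_lt_one hR hK.le hS,
        Eventually.of_forall fun L => torusXYStiffness_pos hK⟩
    have hinv := (hs.inv_tendsto_nhdsGT_zero).const_mul_atTop (inv_pos.2 (by positivity : (0 : ℝ) < 2 * Real.pi))
    refine hinv.congr fun L => ?_
    rw [hfL (L + 1)]
    simp only [Pi.inv_apply, one_div, mul_inv]
  intro h
  refine torusXY_not_uniform_decay_of_tendsto (d := 2) (by norm_num) hK hlim A hB fun L _ hL x y => ?_
  rw [hfL L]
  exact h L hL x y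

end Crux

/-! ## §4 Simon's form: the box number is below the shell sum of any enclosing free box -/

section Simon

omit [NeZero L] in
/-- **`S_R(K)` is at most the shell sum of the two-point function of ANY finite free box containing `[−R, R]^ν`**:
`S_R(K) ≤ ∑_{b ∈ Λ, ‖b‖_∞ = R} ⟨cos(θ_0 − θ_b)⟩_{Λ,K}` (the reference inside system has the shell–shell bonds removed
and no bonds outside the box: Griffiths–Ginibre comparison under the inclusion `[−R,R]^ν ↪ Λ`). Hence Simon's
criterion — a shell sum `< 1` of the two-point function in some finite volume — implies Lieb's `S_R(K) < 1`.
[cite: Simon1980CMP, Thm 1.3 (∑_{b ∈ B} ⟨σ_0σ_b⟩ < 1 ⇒ exponential decay); Lieb1980, p. 128 and p. 133 (B–B interactions part of H_C)] -/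
theorem nnBoxShellSum_le_sum_shell_twoPoint {K : ℝ} (hK : 0 ≤ K) {ν R : ℕ} (Λ : Finset (Site ν))
    (hΛ : box ν R ⊆ Λ) :
    nnBoxShellSum K ν R ≤ ∑ b ∈ Finset.univ.filter (fun b : Λ => Site.supNorm (b : Site ν) = R),
      PlaneRotator.twoPoint (nnXYCoupling K ν Λ) ⟨0, hΛ (zero_mem_box ν R)⟩ b := by
  classical
  set Jf : Site ν → Site ν → ℝ := fun u v => K / 2 * nnCoupling ν u v with hJf
  have hJf0 : ∀ u v, 0 ≤ Jf u v := fun u v => mul_nonneg (div_nonneg hK zero_le_two) (nnCoupling_nonneg _ _)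
  have hnn0 : ∀ p : Λ × Λ, 0 ≤ nnXYCoupling K ν Λ p := fun p =>
    mul_nonneg (div_nonneg hK zero_le_two) (nnCoupling_nonneg _ _)
  -- the inclusion of the reference box into `Λ`
  let τ : box ν R → Λ := fun b => ⟨(b : Site ν), hΛ b.2⟩
  have hτv : ∀ b : box ν R, ((τ b : Λ) : Site ν) = (b : Site ν) := fun b => rfl
  have hτ : Function.Injective τ := fun b b' h => Subtype.ext (by rw [← hτv b, ← hτv b', h])
  have hdom : ∀ x y : box ν R, refCoupling Jf R (x, y) ≤ nnXYCoupling K ν Λ (τ x, τ y) := by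
    intro x y
    unfold refCoupling
    split_ifs with h
    · exact hnn0 _
    · exact le_rfl
  have h0 : τ (refCentre ν R) = ⟨0, hΛ (zero_mem_box ν R)⟩ := rfl
  calc nnBoxShellSum K ν R
      = ∑ b ∈ refShell ν R, PlaneRotator.twoPoint (refCoupling Jf R) (refCentre ν R) b := rfl
    _ ≤ ∑ b ∈ refShell ν R, PlaneRotator.twoPoint (nnXYCoupling K ν Λ) (τ (refCentre ν R)) (τ b) :=
        Finset.sum_le_sum fun b _ =>
          twoPoint_le_of_embedding hτ (refCoupling_nonneg hJf0 R) hnn0 hdom (refCentre ν R) b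
    _ = ∑ b' ∈ (refShell ν R).image τ, PlaneRotator.twoPoint (nnXYCoupling K ν Λ) (τ (refCentre ν R)) b' := by
        rw [Finset.sum_image fun x _ y _ h => hτ h]
    _ ≤ ∑ b ∈ Finset.univ.filter (fun b : Λ => Site.supNorm (b : Site ν) = R),
          PlaneRotator.twoPoint (nnXYCoupling K ν Λ) ⟨0, hΛ (zero_mem_box ν R)⟩ b := by
        rw [h0]
        refine Finset.sum_le_sum_of_subset_of_nonneg (fun b' hb' => ?_) fun b' _ _ => twoPoint_nonneg hnn0 _ _
        obtain ⟨b, hb, rfl⟩ := Finset.mem_image.1 hb'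
        simp only [refShell, Finset.mem_filter, Finset.mem_univ, true_and] at hb
        simp only [Finset.mem_filter, Finset.mem_univ, true_and, hτv]
        exact hb

omit [NeZero L] in
/-- **Simon's criterion for the stiffness.** If in SOME finite free box `Λ ⊇ [−R, R]²` (`R ≥ 1`) the shell sum of the
two-point function is `< 1`, `∑_{b ∈ Λ, ‖b‖_∞ = R} ⟨cos(θ_0 − θ_b)⟩_{Λ,K} < 1`, then `βΥ_L(K) → 0` (`K ≥ 0`).
[cite: Simon1980CMP, Thm 1.3; Lieb1980, Theorem 4 and p. 128] -/
theorem tendsto_torusXYStiffness_of_shell_sum_lt_one {R : ℕ} (hR : 1 ≤ R) {K : ℝ} (hK : 0 ≤ K)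
    (Λ : Finset (Site 2)) (hΛ : box 2 R ⊆ Λ)
    (hsum : ∑ b ∈ Finset.univ.filter (fun b : Λ => Site.supNorm (b : Site 2) = R),
      PlaneRotator.twoPoint (nnXYCoupling K 2 Λ) ⟨0, hΛ (zero_mem_box 2 R)⟩ b < 1) :
    Tendsto (fun L : ℕ => torusXYStiffness (L + 1) K) atTop (𝓝 0) :=
  tendsto_torusXYStiffness_of_nnBoxShellSum_lt_one hR hK
    ((nnBoxShellSum_le_sum_shell_twoPoint hK Λ hΛ).trans_lt hsum)

omit [NeZero L] in
/-- **The low-temperature side read backwards (Simon's lower bound for the stiffness phase).** If `βΥ_{L+1}(K)` does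
NOT tend to `0` (`K ≥ 0`), then for EVERY radius `R ≥ 1` and every finite free box `Λ ⊇ [−R, R]²` the shell sum of the
two-point function is at least one: `∑_{b ∈ Λ, ‖b‖_∞ = R} ⟨cos(θ_0 − θ_b)⟩_{Λ,K} ≥ 1` — so on every shell some site has
`⟨cos(θ_0 − θ_b)⟩_{Λ,K} ≥ 1/(8R)`: a phase with non-vanishing torus stiffness has two-point functions decaying no
faster than `1/(8‖x‖_∞)` along shells (the contrapositive of the finite algorithm; the hypothesis `Υ ↛ 0` itself is
Fröhlich–Spencer's theorem at large `K`, not proved here). [cite: Simon1980CMP, Thm 1.3 and the remark on the converse (∑_B ⟨σ_0σ_b⟩ ≥ 1 on every separating set when m = 0); Lieb1980, p. 128] -/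
theorem one_le_sum_shell_twoPoint_of_not_tendsto_torusXYStiffness {K : ℝ} (hK : 0 ≤ K)
    (hnot : ¬ Tendsto (fun L : ℕ => torusXYStiffness (L + 1) K) atTop (𝓝 0)) {R : ℕ} (hR : 1 ≤ R)
    (Λ : Finset (Site 2)) (hΛ : box 2 R ⊆ Λ) :
    1 ≤ ∑ b ∈ Finset.univ.filter (fun b : Λ => Site.supNorm (b : Site 2) = R),
      PlaneRotator.twoPoint (nnXYCoupling K 2 Λ) ⟨0, hΛ (zero_mem_box 2 R)⟩ b := by
  by_contra h
  exact hnot (tendsto_torusXYStiffness_of_shell_sum_lt_one hR hK Λ hΛ (not_le.1 h))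

omit [NeZero L] in
/-- The same for Lieb's number: `Υ ↛ 0 ⇒ S_R(K) ≥ 1` for every `R ≥ 1`. [cite: Lieb1980, Theorem 4 and p. 128 (β ≥ β_c ⇒ φ(β) ≥ 1 for every box)] -/
theorem one_le_nnBoxShellSum_of_not_tendsto_torusXYStiffness {K : ℝ} (hK : 0 ≤ K)
    (hnot : ¬ Tendsto (fun L : ℕ => torusXYStiffness (L + 1) K) atTop (𝓝 0)) {R : ℕ} (hR : 1 ≤ R) :
    1 ≤ nnBoxShellSum K 2 R := by
  by_contra h
  exact hnot (tendsto_torusXYStiffness_of_nnBoxShellSum_lt_one hR hK (not_le.1 h))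

end Simon

end Literature.Probability.LatticeModels
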